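import Literature.NumberTheory.EllipticCurves.NeronModel
import Literature.NumberTheory.DiophantineGeometry.ConductorFactorizationProofs
import Literature.NumberTheory.DiophantineGeometry.ConductorMultiplicativeProofs
import Literature.NumberTheory.DiophantineGeometry.MinimalDiscriminantFactorizationProofs
import Literature.NumberTheory.DiophantineGeometry.TateAlgorithmProofs
import HarnessLib

/-!
# `#Φ_r(E) = m_r = ord_r Δ_min(E)` at a prime `r` of the squarefree conductor

Topic `NumberTheory/EllipticCurves`; theorems only (no definition, no named fact, no instance).
Identification (ii) of `Literature/NumberTheory/EllipticCurves/TakahashiDegreeFormula.lean`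
(Takahashi 2001, §1 p. 75: "let `c_r` be the number of connected components of the fiber at `r`
of the Néron model of `E` (i.e., `c_r = ord_r(Δ)` where `Δ` is the minimal discriminant of `E`)")
— input (M3) of the proof file of the named fact `takahashi2001_thm_2_3` — in the vocabulary of
the tree, assembled from discharged facts of `DiophantineGeometry/`:

* `kodairaSymbolAt_eq_I_of_conductorExponent_eq_one` — `f_v = 1` forces the Kodaira symbol `Iₙ`
  with `n = ord_v Δ_min ≥ 1` (`conductorExponent_eq_one_iff_holds`: `f_v = 1 ↔` multiplicative
  reduction, Silverman ATAEC IV.10.2(b); `kodairaSymbolAt_eq_I_iff_holds`: Tate's algorithm step 2,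
  ATAEC IV.9.4; `f_v ≤ ord_v Δ_min`).
* `componentGroupOrder_kodairaSymbolAt_eq`, `numComponentsAt_eq_ordMinimalDiscriminant` — hence
  the geometric component group of the Néron fibre has order `ord_v Δ_min`, which is also the
  number `m_v` of components (Néron's table: `Iₙ ↦ ℤ/n`, `n` components).
* `conductorExponent_eq_one_of_squarefree` — for an elliptic curve over `ℚ` of squarefree conductor
  `N` and a prime `r ∣ N`, `f_r = 1` (`factorization_conductorNorm_holds`: `N = ∏ p^{f_p}`).
* `componentGroupOrder_eq_factorization_minimalDiscriminantNorm`,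
  `card_neronComponent_eq_factorization_minimalDiscriminantNorm` — **`#Φ_r(E) = ord_r Δ_min(E) =
  (W.minimalDiscriminantNorm ℤ).factorization r ≥ 1`** for every `r ∣ N`, `N` the squarefree
  conductor, and for every component datum `NeronComponentData W v_r` (`Φ` its geometric
  component group; `factorization_minimalDiscriminantNorm_holds`: `|Δ_min| = ∏ p^{ord_p Δ_min}`).
  This is the `c_r = (W.minimalDiscriminantNorm ℤ).factorization r` of the named fact, justified.

## References

* [Takahashi2001] S. Takahashi, J. Number Theory 90 (2001), §1 p. 75 (`c_r = ord_r(Δ)`).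
* [SilvermanATAEC1994] J. H. Silverman, *Advanced Topics*, GTM 151, IV.9.4 (Tate's algorithm,
  step 2), Table 4.1, Cor. IV.9.2, IV.10.2(b), IV.11.1 (Ogg's formula).
-/

noncomputable section

open IsDedekindDomain

namespace Literature.NumberTheory.EllipticCurves

open Literature.NumberTheory.DiophantineGeometry

/-! ### Local: a place with `f_v = 1` -/

section Local

variable (W : WeierstrassCurve ℚ) [W.IsElliptic] (v : HeightOneSpectrum ℤ)

/-- **`f_v = 1` forces type `Iₙ`, `n = ord_v Δ_min ≥ 1`**: `f_v = 1` iff multiplicative reduction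
(Silverman ATAEC IV.10.2(b), tree `conductorExponent_eq_one_iff_holds`), Tate's algorithm then
returns `Iₙ` with `n = ord_v Δ_min` (IV.9.4 step 2, tree `kodairaSymbolAt_eq_I_iff_holds`), and
`n ≥ f_v = 1` (`conductorExponent_le_ordMinimalDiscriminant`). Over `ℚ` the residue fields are
finite, so no perfectness hypothesis remains. [cite: SilvermanATAEC1994, IV.9.4 step 2 and IV.10.2(b)] -/
theorem kodairaSymbolAt_eq_I_of_conductorExponent_eq_one (h1 : W.conductorExponent v = 1) :
    W.kodairaSymbolAt v = .I (W.ordMinimalDiscriminant v) ∧ 0 < W.ordMinimalDiscriminant v := by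
  have hmult : W.HasMultiplicativeReductionAt v :=
    (WeierstrassCurve.conductorExponent_eq_one_iff_holds v W).mp h1
  have hpos : 0 < W.ordMinimalDiscriminant v := by
    have := WeierstrassCurve.conductorExponent_le_ordMinimalDiscriminant v W
    omega
  exact ⟨(WeierstrassCurve.kodairaSymbolAt_eq_I_iff_holds v W hpos.ne').mpr ⟨hmult, rfl⟩, hpos⟩

/-- **The geometric component group at a place with `f_v = 1` has order `ord_v Δ_min`**
(Néron's table: type `Iₙ` has component group `ℤ/n`; Silverman ATAEC IV, Table 4.1 and
Cor. IV.9.2; tree `KodairaSymbol.componentGroupOrder`). [cite: SilvermanATAEC1994, IV Table 4.1 and Cor. IV.9.2] -/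
theorem componentGroupOrder_kodairaSymbolAt_eq (h1 : W.conductorExponent v = 1) :
    (W.kodairaSymbolAt v).componentGroupOrder = W.ordMinimalDiscriminant v := by
  obtain ⟨hI, hpos⟩ := kodairaSymbolAt_eq_I_of_conductorExponent_eq_one W v h1
  rw [hI, KodairaSymbol.componentGroupOrder]
  exact max_eq_left hpos

/-- **`m_v = ord_v Δ_min` at a place with `f_v = 1`**: the special fibre of the minimal regular
(= Néron, type `Iₙ`) model has `n = ord_v Δ_min` components (Silverman ATAEC IV, Table 4.1; this
is Ogg's formula `f_v = ord_v Δ_min + 1 - m_v` read at `f_v = 1`). [cite: SilvermanATAEC1994, IV Table 4.1 and IV.11.1] -/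
theorem numComponentsAt_eq_ordMinimalDiscriminant (h1 : W.conductorExponent v = 1) :
    W.numComponentsAt v = W.ordMinimalDiscriminant v := by
  obtain ⟨hI, hpos⟩ := kodairaSymbolAt_eq_I_of_conductorExponent_eq_one W v h1
  obtain ⟨k, hk⟩ := Nat.exists_eq_succ_of_ne_zero hpos.ne'
  rw [WeierstrassCurve.numComponentsAt, hI, hk]
  rfl

end Local

/-! ### Global: primes of the squarefree conductor -/

section Global

variable (W : WeierstrassCurve ℚ) [W.IsElliptic]

/-- **At a prime of the squarefree conductor, `f = 1`**: if `N_E = N` is squarefree and the prime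
below `v` divides `N`, then `f_v = 1` (`N_E = ∏_p p^{f_p}`, tree `factorization_conductorNorm_holds`;
a squarefree number has all exponents `≤ 1`). [folklore] -/
theorem conductorExponent_eq_one_of_squarefree (v : HeightOneSpectrum ℤ) {N : ℕ}
    (hN : W.conductorNorm ℤ = N) (hsq : Squarefree N)
    (hv : Rat.HeightOneSpectrum.natGenerator v ∣ N) : W.conductorExponent v = 1 := by
  have hf := W.factorization_conductorNorm_holds v
  rw [hN] at hf
  rw [← hf]
  have hle := hsq.natFactorization_le_one (Rat.HeightOneSpectrum.natGenerator v)
  have hpos := (Rat.HeightOneSpectrum.prime_natGenerator v).factorization_pos_of_dvd hsq.ne_zero hv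
  omega

/-- The place of `ℤ` at the prime `r` (`Rat.HeightOneSpectrum.primesEquiv`) has `natGenerator = r`.
[folklore] -/
theorem natGenerator_primesEquiv_symm {r : ℕ} (hr : r.Prime) :
    Rat.HeightOneSpectrum.natGenerator
        ((Rat.HeightOneSpectrum.primesEquiv (R := ℤ)).symm ⟨r, hr⟩) = r :=
  congrArg Subtype.val ((Rat.HeightOneSpectrum.primesEquiv (R := ℤ)).apply_symm_apply ⟨r, hr⟩)

/-- **`#Φ_r(E) = ord_r Δ_min(E)` at the primes of a squarefree conductor, Kodaira form**: for an
elliptic curve `E/ℚ` (model `W`) of squarefree conductor `N` and a prime `r ∣ N`, at the place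
`v_r` the component-group order of the Kodaira symbol is
`(W.minimalDiscriminantNorm ℤ).factorization r = ord_r Δ_min ≥ 1` (Takahashi 2001, p. 75:
"`c_r = ord_r(Δ)`"; Silverman ATAEC IV Table 4.1; tree `factorization_minimalDiscriminantNorm_holds`).
This is identification (ii), `c_r := (W.minimalDiscriminantNorm ℤ).factorization r`, of the named
fact `takahashi2001_thm_2_3`. [cite: Takahashi2001, §1 p. 75 (c_r = ord_r Δ)] -/
theorem componentGroupOrder_eq_factorization_minimalDiscriminantNorm {N : ℕ}
    (hN : W.conductorNorm ℤ = N) (hsq : Squarefree N) {r : ℕ} (hr : r.Prime) (hrN : r ∣ N) :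
    (W.kodairaSymbolAt ((Rat.HeightOneSpectrum.primesEquiv (R := ℤ)).symm ⟨r, hr⟩)).componentGroupOrder =
        (W.minimalDiscriminantNorm ℤ).factorization r ∧
      0 < (W.minimalDiscriminantNorm ℤ).factorization r := by
  set v := (Rat.HeightOneSpectrum.primesEquiv (R := ℤ)).symm ⟨r, hr⟩ with hv
  have hgen : Rat.HeightOneSpectrum.natGenerator v = r := natGenerator_primesEquiv_symm hr
  have h1 : W.conductorExponent v = 1 :=
    conductorExponent_eq_one_of_squarefree W v hN hsq (hgen ▸ hrN)
  have hΔ := W.factorization_minimalDiscriminantNorm_holds v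
  rw [hgen] at hΔ
  rw [hΔ, componentGroupOrder_kodairaSymbolAt_eq W v h1]
  exact ⟨rfl, (kodairaSymbolAt_eq_I_of_conductorExponent_eq_one W v h1).2⟩

/-- The same for the number of components: **`m_r = ord_r Δ_min(E)`** at every prime `r` of the
squarefree conductor. [cite: SilvermanATAEC1994, IV Table 4.1 and IV.11.1] -/
theorem numComponentsAt_eq_factorization_minimalDiscriminantNorm {N : ℕ}
    (hN : W.conductorNorm ℤ = N) (hsq : Squarefree N) {r : ℕ} (hr : r.Prime) (hrN : r ∣ N) :
    W.numComponentsAt ((Rat.HeightOneSpectrum.primesEquiv (R := ℤ)).symm ⟨r, hr⟩) =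
      (W.minimalDiscriminantNorm ℤ).factorization r := by
  set v := (Rat.HeightOneSpectrum.primesEquiv (R := ℤ)).symm ⟨r, hr⟩ with hv
  have hgen : Rat.HeightOneSpectrum.natGenerator v = r := natGenerator_primesEquiv_symm hr
  have h1 : W.conductorExponent v = 1 :=
    conductorExponent_eq_one_of_squarefree W v hN hsq (hgen ▸ hrN)
  have hΔ := W.factorization_minimalDiscriminantNorm_holds v
  rw [hgen] at hΔ
  rw [hΔ, numComponentsAt_eq_ordMinimalDiscriminant W v h1]

/-- **`#Φ_r(E) = ord_r Δ_min(E)` for every Néron component datum** at a prime `r` of the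
squarefree conductor `N` of `E/ℚ`: the geometric component group `Φ` of any
`NeronComponentData W v_r` (tree `NeronModel.lean`: `#Φ` is the order attached to the Kodaira
symbol) has exactly `(W.minimalDiscriminantNorm ℤ).factorization r` elements — Takahashi's
`c_r = #Φ_r(E) = ord_r(Δ)` (2001, p. 75) in the tree's vocabulary. [cite: Takahashi2001, §1 p. 75 (c_r = #Φ_r(E) = ord_r Δ)] -/
theorem card_neronComponent_eq_factorization_minimalDiscriminantNorm {N : ℕ}
    (hN : W.conductorNorm ℤ = N) (hsq : Squarefree N) {r : ℕ} (hr : r.Prime) (hrN : r ∣ N)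
    (D : NeronComponentData W ((Rat.HeightOneSpectrum.primesEquiv (R := ℤ)).symm ⟨r, hr⟩)) :
    Fintype.card D.Φ = (W.minimalDiscriminantNorm ℤ).factorization r := by
  rw [D.card_eq, (componentGroupOrder_eq_factorization_minimalDiscriminantNorm W hN hsq hr hrN).1]

end Global

end Literature.NumberTheory.EllipticCurves

end
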